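import Summits.Ventures.HodgeRepro.BallCongruenceNF

/-!
# The iterated `Γ″` of Lemma W: congruence level and finite index for finitely many Hecke elements (seat p3)

Blind re-derivation cell `pub-hodge-repro`, seat `p3`.  Built on seat p5's `BallCongruence.lean` /
`BallCongruenceNF.lean` (`arith φ = U(2,1)(R)`, `congr φ hφ M = Γ(M)`, Hecke conjugation
`congr_le_conjSub : Γ(N²M) ≤ g⁻¹ Γ(M) g`, `IsKRational σ g` = «`g ∈ U(2,1)(K)`», `exists_denominator`,
`isFiniteRelIndex_inf_conjSub_numberField`) and `BallInvariance.lean` (`pull`, `wedgeForm`, `conjSub`,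
`IsInvariant`, `IsInvariantTop`).  Mathlib otherwise.

ROUTE.md Appendix A4 (Lemma W) passes from one Hecke translate to several: the iteration (R5) uses
`Γ″ := Γ′ ∩ ⋂ᵢ gᵢ⁻¹ Γ′ gᵢ`, «congruence, finite index».  p5's files state both clauses for ONE `g`
(`lemmaW_finiteCover`); this file adds what the iteration needs, on the sealed `U(2,1)`:

* `congr_le_inf_conjSub` — **the «congruence» half as a theorem** (generic `R`): if `N·g`, `N·g⁻¹` are
  integral and `Γ(M) ≤ Γ′` then `Γ(N² M) ≤ Γ′ ⊓ g⁻¹ Γ′ g`;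
* `exists_congr_le_inf_conjSub_numberField` — for `K`-rational `g`: `Γ′ ⊓ g⁻¹ Γ′ g` contains some
  `Γ(L)`, `L ≠ 0` (it is a congruence subgroup);
* `exists_congr_le_inf_iInf_conjSub_numberField` — **finitely many `K`-rational `g₁, …, g_k`**:
  `Γ′ ⊓ ⨅ᵢ gᵢ⁻¹ Γ′ gᵢ` contains `Γ(L)` for the common level `L = M · ∏ᵢ Nᵢ²`;
* `isFiniteRelIndex_inf_iInf_conjSub_numberField` — **the iterated finite index**: `Γ′ ⊓ ⨅ᵢ gᵢ⁻¹ Γ′ gᵢ`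
  has finite index in `Γ′` (two proofs: from the common level, and from `Subgroup.finiteIndex_iInf`);
* `lemmaW_iter_finiteCover` — the iterated `Γ″` at `p = 2`: for `Γ′`-invariant fields `F, G` and
  `K`-rational `g₁, …, g_k`, every `(gᵢ^*F) ∧ (gⱼ^*G)` is a `Γ″`-invariant `(2,0)`-form, and `Γ″` is a
  congruence subgroup of finite index in `Γ′`.

Nothing here says anything about the status of the Hodge conjecture for CM abelian varieties, which is
NOT proved.
-/

set_option autoImplicit false

noncomputable section

universe u

namespace Summit.Ventures.HodgeRepro

namespace HeckeWedgeLemmaW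

open Matrix hiding J
open BallModel BallCore BallInv BallCong NumberField

/-! ### The «congruence» half, generic ring -/

section generic

variable {R : Type u} [CommRing R] (φ : R →+* ℂ) (hφ : Function.Injective φ)

/-- **The «congruence» half of A4's «`Γ″` (congruence, finite index)».**  If `N · g` and `N · g⁻¹` are
integral (`φ A = N • mat g`, `φ B = N • mat g⁻¹`) and `Γ(M) ≤ Γ′`, then the principal congruence subgroup
`Γ(N² M)` lies in `Γ′ ⊓ g⁻¹ Γ′ g`. -/
theorem congr_le_inf_conjSub {Γ' : Subgroup U21} {M : R} (hM : congr φ hφ M ≤ Γ') (g : U21) (N : R)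
    (A B : Matrix (Fin 3) (Fin 3) R) (hA : Mφ φ A = φ N • mat g) (hB : Mφ φ B = φ N • mat g⁻¹) :
    congr φ hφ (N ^ 2 * M) ≤ Γ' ⊓ conjSub g Γ' :=
  le_inf ((congr_le_congr_of_dvd φ hφ (Dvd.intro_left _ rfl)).trans hM)
    ((congr_le_conjSub φ hφ g N M A B hA hB).trans (conjSub_mono g hM))

end generic

/-! ### Number fields: congruence level and finite index of the iterated `Γ″` -/

section numberField

variable {K : Type u} [Field K] [NumberField K] (σ : K →+* ℂ)

/-- **`Γ′ ⊓ g⁻¹ Γ′ g` is a congruence subgroup** for `K`-rational `g`: it contains `Γ(N² M)` for a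
denominator `N ≠ 0` of `g`. -/
theorem exists_congr_le_inf_conjSub_numberField {Γ' : Subgroup U21} {M : 𝓞 K} (hM0 : M ≠ 0)
    (hM : congr (φ𝓞 K σ) (φ𝓞_injective K σ) M ≤ Γ') {g : U21} (hg : IsKRational K σ g) :
    ∃ L : 𝓞 K, L ≠ 0 ∧ congr (φ𝓞 K σ) (φ𝓞_injective K σ) L ≤ Γ' ⊓ conjSub g Γ' := by
  obtain ⟨N, hN, A, B, hA, hB⟩ := exists_denominator K σ hg
  exact ⟨N ^ 2 * M, mul_ne_zero (pow_ne_zero 2 hN) hM0,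
    congr_le_inf_conjSub (φ𝓞 K σ) (φ𝓞_injective K σ) hM g N A B hA hB⟩

/-- **Finitely many Hecke elements: a common congruence level.**  For `K`-rational `g₁, …, g_k` (indexed
by a finite type) and `Γ(M) ≤ Γ′`, `M ≠ 0`, the iterated `Γ″ = Γ′ ⊓ ⨅ᵢ gᵢ⁻¹ Γ′ gᵢ` contains the principal
congruence subgroup `Γ(L)` of the common level `L = M · ∏ᵢ Nᵢ² ≠ 0` (`Nᵢ` a denominator of `gᵢ`). -/
theorem exists_congr_le_inf_iInf_conjSub_numberField {Γ' : Subgroup U21} {M : 𝓞 K} (hM0 : M ≠ 0)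
    (hM : congr (φ𝓞 K σ) (φ𝓞_injective K σ) M ≤ Γ') {ι : Type*} [Finite ι] {g : ι → U21}
    (hg : ∀ i, IsKRational K σ (g i)) :
    ∃ L : 𝓞 K, L ≠ 0 ∧ congr (φ𝓞 K σ) (φ𝓞_injective K σ) L ≤ Γ' ⊓ ⨅ i, conjSub (g i) Γ' := by
  cases nonempty_fintype ι
  choose N hN A B hA hB using fun i => exists_denominator K σ (hg i)
  refine ⟨M * ∏ i, N i ^ 2, mul_ne_zero hM0 (Finset.prod_ne_zero_iff.2 fun i _ => pow_ne_zero 2 (hN i)),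
    le_inf ((congr_le_congr_of_dvd _ _ (Dvd.intro _ rfl)).trans hM) (le_iInf fun i => ?_)⟩
  have hdvd : N i ^ 2 * M ∣ M * ∏ j, N j ^ 2 := by
    rw [mul_comm (N i ^ 2) M]
    exact mul_dvd_mul_left M (Finset.dvd_prod_of_mem _ (Finset.mem_univ i))
  exact (congr_le_congr_of_dvd _ _ hdvd).trans
    ((congr_le_inf_conjSub (φ𝓞 K σ) (φ𝓞_injective K σ) hM (g i) (N i) (A i) (B i) (hA i) (hB i)).trans
      inf_le_right)

/-- **The iterated finite-index clause** (A4's `Γ″ = Γ′ ∩ ⋂ᵢ gᵢ⁻¹ Γ′ gᵢ`): for `K`-rational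
`g₁, …, g_k` and `Γ(M) ≤ Γ′ ≤ U(2,1)(𝓞_K)`, `M ≠ 0`, the subgroup `Γ′ ⊓ ⨅ᵢ gᵢ⁻¹ Γ′ gᵢ` has finite index
in `Γ′` (proof from the common congruence level `Γ(L)` of finite index in `U(2,1)(𝓞_K)`). -/
theorem isFiniteRelIndex_inf_iInf_conjSub_numberField {Γ' : Subgroup U21}
    (hΓ : Γ' ≤ arith (φ𝓞 K σ)) {M : 𝓞 K} (hM0 : M ≠ 0)
    (hM : congr (φ𝓞 K σ) (φ𝓞_injective K σ) M ≤ Γ') {ι : Type*} [Finite ι] {g : ι → U21}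
    (hg : ∀ i, IsKRational K σ (g i)) :
    (Γ' ⊓ ⨅ i, conjSub (g i) Γ').IsFiniteRelIndex Γ' := by
  obtain ⟨L, hL, hle⟩ := exists_congr_le_inf_iInf_conjSub_numberField σ hM0 hM hg
  haveI : Finite (𝓞 K ⧸ Ideal.span {L}) := finite_quotient_span_of_ne_zero hL
  haveI : (congr (φ𝓞 K σ) (φ𝓞_injective K σ) L).IsFiniteRelIndex (arith (φ𝓞 K σ)) :=
    isFiniteRelIndex_congr _ _ L
  haveI : (congr (φ𝓞 K σ) (φ𝓞_injective K σ) L).IsFiniteRelIndex Γ' :=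
    Subgroup.isFiniteRelIndex_of_le_right _ hΓ
  exact Subgroup.isFiniteRelIndex_of_le_left Γ' hle

/-- The same by intersecting finitely many finite-index subgroups (`Subgroup.finiteIndex_iInf`), from
p5's one-element clause `isFiniteRelIndex_inf_conjSub_numberField`. -/
theorem isFiniteRelIndex_inf_iInf_conjSub_numberField' {Γ' : Subgroup U21}
    (hΓ : Γ' ≤ arith (φ𝓞 K σ)) {M : 𝓞 K} (hM0 : M ≠ 0)
    (hM : congr (φ𝓞 K σ) (φ𝓞_injective K σ) M ≤ Γ') {ι : Type*} [Finite ι] {g : ι → U21}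
    (hg : ∀ i, IsKRational K σ (g i)) :
    (Γ' ⊓ ⨅ i, conjSub (g i) Γ').IsFiniteRelIndex Γ' := by
  rw [Subgroup.isFiniteRelIndex_iff_finiteIndex, Subgroup.inf_subgroupOf_left,
    show (⨅ i, conjSub (g i) Γ').subgroupOf Γ' = ⨅ i, (conjSub (g i) Γ').subgroupOf Γ' from
      Subgroup.comap_iInf _ _]
  refine Subgroup.finiteIndex_iInf fun i => ?_
  have h := isFiniteRelIndex_inf_conjSub_numberField K σ hΓ hM0 hM (hg i)
  rwa [Subgroup.isFiniteRelIndex_iff_finiteIndex, Subgroup.inf_subgroupOf_left] at h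

/-! ### The iterated `Γ″` at `p = 2` -/

/-- **The iterated `Γ″` of Lemma W at `p = 2`.**  Let `Γ(M) ≤ Γ′ ≤ U(2,1)(𝓞_K)`, `M ≠ 0`, let
`g₁, …, g_k ∈ U(2,1)(K)` be finitely many Hecke elements and `F, G` two `Γ′`-invariant cotangent fields on
the ball.  Then `Γ″ := Γ′ ⊓ ⨅ᵢ gᵢ⁻¹ Γ′ gᵢ` is a congruence subgroup (it contains some `Γ(L)`, `L ≠ 0`) of
finite index in `Γ′`, every translate `gᵢ^*F`, `gⱼ^*G` is `Γ″`-invariant, and every `(2,0)`-form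
`(gᵢ^*F) ∧ (gⱼ^*G)` is `Γ″`-invariant. -/
theorem lemmaW_iter_finiteCover {Γ' : Subgroup U21} (hΓ : Γ' ≤ arith (φ𝓞 K σ)) {M : 𝓞 K}
    (hM0 : M ≠ 0) (hM : congr (φ𝓞 K σ) (φ𝓞_injective K σ) M ≤ Γ') {ι : Type*} [Finite ι]
    {g : ι → U21} (hg : ∀ i, IsKRational K σ (g i)) {F G : Ball → Fin 2 → ℂ}
    (hF : IsInvariant Γ' F) (hG : IsInvariant Γ' G) :
    (∃ L : 𝓞 K, L ≠ 0 ∧ congr (φ𝓞 K σ) (φ𝓞_injective K σ) L ≤ Γ' ⊓ ⨅ i, conjSub (g i) Γ') ∧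
      (Γ' ⊓ ⨅ i, conjSub (g i) Γ').IsFiniteRelIndex Γ' ∧
      (∀ i, IsInvariant (Γ' ⊓ ⨅ i, conjSub (g i) Γ') (pull (g i) F)) ∧
      (∀ j, IsInvariant (Γ' ⊓ ⨅ i, conjSub (g i) Γ') (pull (g j) G)) ∧
      ∀ i j, IsInvariantTop (Γ' ⊓ ⨅ i, conjSub (g i) Γ') (wedgeForm (pull (g i) F) (pull (g j) G)) := by
  have hle : ∀ i, Γ' ⊓ ⨅ i, conjSub (g i) Γ' ≤ conjSub (g i) Γ' := fun i =>
    inf_le_right.trans (iInf_le _ i)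
  have hFi : ∀ i, IsInvariant (Γ' ⊓ ⨅ i, conjSub (g i) Γ') (pull (g i) F) := fun i =>
    (isInvariant_pull_conj hF (g i)).mono (hle i)
  have hGj : ∀ j, IsInvariant (Γ' ⊓ ⨅ i, conjSub (g i) Γ') (pull (g j) G) := fun j =>
    (isInvariant_pull_conj hG (g j)).mono (hle j)
  exact ⟨exists_congr_le_inf_iInf_conjSub_numberField σ hM0 hM hg,
    isFiniteRelIndex_inf_iInf_conjSub_numberField σ hΓ hM0 hM hg, hFi, hGj,
    fun i j => isInvariantTop_wedgeForm (hFi i) (hGj j)⟩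

end numberField

end HeckeWedgeLemmaW

end Summit.Ventures.HodgeRepro

end
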